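import Summits.HodgeConjecture.CorCM.Census.TwistGenerationResidual

/-!
# Uniform twist generation, VI: THE PROFILE CORNERS — deviation sets and near classes of the profile types and of their flips

COR-CM (cell `pub-hodgecm2`), count-neutral kernel combinatorics by the binder seat b09 (gen 36; lane UNIFORM TWIST GENERATION, part VI), on
parts I–V used BY NAME.  Theorems only: no definition, no `decide`, no certificate, no named fact, no `sorry`.
HONEST FRAMING: `HC_CM` is NOT proved, here or anywhere in the tree; nothing here is a period or a headline.

Along a datum `θ : G ≃ ℤ/2n × B` with `n ≥ 2`: the profile type `prof Q` (columns `b ∈ Q` at the arc `1`, the others at the arc `0`) and its flips at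
an interior place `θ⁻¹(k, b₁)` (`1 ≤ k < n`, `b₁ ∉ Q`) are the corners of the closing faces of part VII.  Here:
* §1 (flips depend only on the place: `BlockParity.oflipCM_cmul`); the flip of `prof Q` at `θ⁻¹(0, b)` is `prof (insert b Q)`; deviation sets from the centres
  `cst 0` (`= θ⁻¹(0 × Q)`) and `cst 1` (`= θ⁻¹(n × Qᶜ)`), the general insert / erase laws of deviation sets under flips, and the star differences
  `θ_T[Φ^{(t)}] − θ_T[Φ] = ±([T^{(t)}] − [T])`;
* §2 distances of the profile corners to the centres `−1, 0, 1, 2` (exact at `0, 1`; witness bounds at `−1, 2`) and **their near classes**: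
  `prof Q ∈ nearCl 0` and `(prof Q)^{(k,b₁)} ∈ nearCl 0` when `2|Q| < |B|`, `3 ≤ |B|`; `prof Q' ∈ nearCl 1` and `(prof Q')^{(k,b₁)} ∈ nearCl 1` when
  `|B| ≤ 2|Q'|`, `2 ≤ |Q'|`, `3 ≤ |B|` (the UPPER rule: for even `|B|` the corner `prof Q'` ties between the centres `0` and `1`).

## References
* [Pohlmann1968] H. Pohlmann, Algebraic cycles on abelian varieties of complex multiplication type, Ann. of Math. 88 (1968), Thm 1.
* [Milne1999] J. S. Milne, Lefschetz motives and the Tate conjecture, Compositio Math. 117 (1999), Prop. 2.1, p. 54.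
-/

namespace Summit.HodgeConjecture.CorCM.Census.TwistGeneration

open Finset
open Summit.HodgeConjecture.CorCM.Prior.AllgGroup.RfwfAllgGroup
open Summit.HodgeConjecture.CorCM.Census.BlockParity
open Summit.HodgeConjecture.CorCM.Census.Coinvariant
open scoped symmDiff

noncomputable section

variable {G : Type*} [Group G] [Fintype G] [DecidableEq G] {c : G}
variable {B : Type} [AddGroup B] [DecidableEq B]
variable {n : ℕ} [NeZero n] (θ : G ≃ ZMod (2 * n) × B)
variable (hθ : ∀ P Q : G, θ (P * Q) = θ P + θ Q) (hθc : θ c = (((n : ℕ) : ZMod (2 * n)), 0))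

/-! ## §1 Flips, deviation sets and star differences -/

section Dev

omit [DecidableEq B] in
/-- **Deviation sets under a flip at a common point**: for `t ∈ T ∩ Φ`, `T ∖ Φ^{(t)} = insert t (T ∖ Φ)`. [folklore] -/
theorem sdiff_oflipCM_of_mem (hc2 : c * c = 1) {T Φ : CMF G c} {t : G} (htT : t ∈ T.1) (htΦ : t ∈ Φ.1) :
    T.1 \ (oflipCM c hc2 t Φ).1 = insert t (T.1 \ Φ.1) := by
  have hct : c * t ∉ T.1 := (T.2 t).mp htT
  ext x
  rw [mem_insert, mem_sdiff, mem_sdiff, mem_oflipCM_iff' hc2, mem_orb, not_not]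
  constructor
  · rintro ⟨hxT, hx⟩
    by_cases hxt : x = t
    · exact Or.inl hxt
    · have hxc : x ≠ c * t := fun h => hct (h ▸ hxT)
      exact Or.inr ⟨hxT, fun hxΦ => by rcases hx.mp hxΦ with h | h <;> contradiction⟩
  · rintro (rfl | ⟨hxT, hxΦ⟩)
    · exact ⟨htT, iff_of_true htΦ (Or.inl rfl)⟩
    · have hxt : x ≠ t := fun h => hxΦ (h ▸ htΦ)
      have hxc : x ≠ c * t := fun h => hct (h ▸ hxT)
      exact ⟨hxT, ⟨fun h => absurd h hxΦ, fun h => by rcases h with h | h <;> contradiction⟩⟩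

omit [DecidableEq B] in
/-- **Star difference at a common point**: for `t ∈ T ∩ Φ`, `θ_T[Φ^{(t)}] − θ_T[Φ] = [T^{(t)}] − [T]`. [folklore] -/
theorem thetaG_oflipCM_sub_of_mem (hc2 : c * c = 1) {T Φ : CMF G c} {t : G} (htT : t ∈ T.1) (htΦ : t ∈ Φ.1) :
    thetaG c hc2 T (typeSum G c (Finsupp.single (oflipCM c hc2 t Φ) 1)) - thetaG c hc2 T (typeSum G c (Finsupp.single Φ 1)) =
      Finsupp.single (oflipCM c hc2 t T) 1 - Finsupp.single T 1 := by
  rw [thetaG_typeSum_single, thetaG_typeSum_single, sdiff_oflipCM_of_mem hc2 htT htΦ,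
    sum_insert (fun h => (mem_sdiff.mp h).2 htΦ)]
  abel

omit [DecidableEq B] in
/-- **Star difference at a deviation point**: for `t ∈ T ∖ Φ`, `θ_T[Φ^{(t)}] − θ_T[Φ] = −([T^{(t)}] − [T])`. [folklore] -/
theorem thetaG_oflipCM_sub_of_mem_sdiff (hc2 : c * c = 1) {T Φ : CMF G c} {t : G} (ht : t ∈ T.1 \ Φ.1) :
    thetaG c hc2 T (typeSum G c (Finsupp.single (oflipCM c hc2 t Φ) 1)) - thetaG c hc2 T (typeSum G c (Finsupp.single Φ 1)) =
      -(Finsupp.single (oflipCM c hc2 t T) 1 - Finsupp.single T 1) := by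
  rw [thetaG_typeSum_single, thetaG_typeSum_single, dev_oflip c hc2 (mem_sdiff.mp ht).1 (mem_sdiff.mp ht).2,
    ← add_sum_erase _ _ ht]
  abel

/-- `val (x − 1) < n ↔ 1 ≤ x.val ≤ n` in `ℤ/2n`. [folklore] -/
theorem val_sub_one_lt_iff (x : ZMod (2 * n)) : (x - 1).val < n ↔ 1 ≤ x.val ∧ x.val ≤ n := by
  have hn : 1 ≤ n := Nat.one_le_iff_ne_zero.mpr (NeZero.ne n)
  have h1 : (1 : ZMod (2 * n)).val = 1 := by
    rw [show (1 : ZMod (2 * n)) = ((1 : ℕ) : ZMod (2 * n)) by norm_cast, ZMod.val_natCast, Nat.mod_eq_of_lt (by omega)]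
  have hv := ZMod.val_lt x
  rw [val_sub_eq, h1]
  split_ifs <;> omega

/-- **The flip of `prof Q` at `θ⁻¹(0, b)`** (`b ∉ Q`) is `prof (insert b Q)`. [folklore] -/
theorem oflipCM_prof (hc2 : c * c = 1) (Q : Finset B) {b : B} (hb : b ∉ Q) :
    oflipCM c hc2 (θ.symm (0, b)) (prof θ hθ hθc Q) = prof θ hθ hθc (insert b Q) := by
  have hn : 1 ≤ n := Nat.one_le_iff_ne_zero.mpr (NeZero.ne n)
  apply Subtype.ext; ext P
  obtain ⟨⟨x, b'⟩, rfl⟩ := θ.symm.surjective P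
  rw [mem_oflipCM_iff' hc2, symm_mem_prof, symm_mem_prof, mem_orb, c_mul_symm θ hθ hθc, zero_add]
  simp only [(θ.symm.injective).eq_iff, Prod.mk.injEq, mem_insert]
  have hv := ZMod.val_lt x
  have h0 : x = 0 ↔ x.val = 0 := by rw [← ZMod.val_eq_zero]
  have hxn : x = (n : ZMod (2 * n)) ↔ x.val = n := by
    constructor
    · rintro rfl; exact val_n
    · intro h; apply ZMod.val_injective; rw [h, val_n]
  by_cases hbb : b' = b
  · subst hbb
    simp only [hb, if_false, sub_zero, and_true, if_true, val_sub_one_lt_iff, h0, hxn, or_false]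
    omega
  · simp only [hbb, and_false, or_self, iff_false, not_not, false_or]

omit [DecidableEq B] in
/-- Points of the arc `0`: `θ⁻¹(k, b) ∈ cst 0` for `k < n`. [folklore] -/
theorem symm_natCast_mem_cst_zero {k : ℕ} (hk : k < n) (b : B) : θ.symm ((k : ℕ), b) ∈ (cst θ hθ hθc 0).1 := by
  rw [symm_mem_cst, sub_zero, ZMod.val_cast_of_lt (by omega)]; exact hk

omit [DecidableEq B] in
/-- Points of the arc `1`: `θ⁻¹(k, b) ∈ cst 1` for `1 ≤ k ≤ n`. [folklore] -/
theorem symm_natCast_mem_cst_one {k : ℕ} (hk1 : 1 ≤ k) (hk : k ≤ n) (b : B) : θ.symm ((k : ℕ), b) ∈ (cst θ hθ hθc 1).1 := by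
  rw [symm_mem_cst, val_sub_one_lt_iff, ZMod.val_cast_of_lt (by omega)]; exact ⟨hk1, hk⟩

/-- Interior points of a column outside `Q` lie in `prof Q`: `θ⁻¹(k, b₁) ∈ prof Q` for `k < n`, `b₁ ∉ Q`. [folklore] -/
theorem symm_natCast_mem_prof {k : ℕ} (hk : k < n) (Q : Finset B) {b₁ : B} (hb₁ : b₁ ∉ Q) :
    θ.symm ((k : ℕ), b₁) ∈ (prof θ hθ hθc Q).1 := by
  rw [symm_mem_prof, if_neg hb₁, sub_zero, ZMod.val_cast_of_lt (by omega)]; exact hk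

/-- **Deviation set of `prof Q` from `cst 0`**: the points `θ⁻¹(0, b)`, `b ∈ Q`. [folklore] -/
theorem sdiff_cst_zero_prof (Q : Finset B) :
    (cst θ hθ hθc 0).1 \ (prof θ hθ hθc Q).1 = Q.image fun b => θ.symm (0, b) := by
  have hn : 1 ≤ n := Nat.one_le_iff_ne_zero.mpr (NeZero.ne n)
  ext P
  obtain ⟨⟨x, b⟩, rfl⟩ := θ.symm.surjective P
  rw [mem_sdiff, symm_mem_cst, symm_mem_prof, sub_zero, mem_image]
  simp only [(θ.symm.injective).eq_iff, Prod.mk.injEq]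
  have h0 : x = 0 ↔ x.val = 0 := by rw [← ZMod.val_eq_zero]
  constructor
  · rintro ⟨hx, hx'⟩
    by_cases hbQ : b ∈ Q
    · rw [if_pos hbQ, val_sub_one_lt_iff] at hx'
      exact ⟨b, hbQ, by rw [eq_comm, h0]; omega, rfl⟩
    · rw [if_neg hbQ, sub_zero] at hx'; exact absurd hx hx'
  · rintro ⟨b', hb', hxb, rfl⟩
    rw [← hxb, ZMod.val_zero, if_pos hb', val_sub_one_lt_iff, ZMod.val_zero]
    exact ⟨by omega, by omega⟩

variable [Fintype B]

/-- **Deviation set of `prof Q` from `cst 1`**: the points `θ⁻¹(n, b)`, `b ∉ Q`. [folklore] -/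
theorem sdiff_cst_one_prof (Q : Finset B) :
    (cst θ hθ hθc 1).1 \ (prof θ hθ hθc Q).1 = (univ.filter fun b => b ∉ Q).image fun b => θ.symm ((n : ℕ), b) := by
  have hn : 1 ≤ n := Nat.one_le_iff_ne_zero.mpr (NeZero.ne n)
  ext P
  obtain ⟨⟨x, b⟩, rfl⟩ := θ.symm.surjective P
  rw [mem_sdiff, symm_mem_cst, symm_mem_prof, val_sub_one_lt_iff, mem_image]
  simp only [(θ.symm.injective).eq_iff, Prod.mk.injEq, mem_filter, mem_univ, true_and]
  have hxn : x = (n : ZMod (2 * n)) ↔ x.val = n := by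
    constructor
    · rintro rfl; exact val_n
    · intro h; apply ZMod.val_injective; rw [h, val_n]
  constructor
  · rintro ⟨hx, hx'⟩
    by_cases hbQ : b ∈ Q
    · rw [if_pos hbQ, val_sub_one_lt_iff] at hx'; exact absurd hx hx'
    · rw [if_neg hbQ, sub_zero] at hx'
      exact ⟨b, hbQ, by rw [eq_comm, hxn]; omega, rfl⟩
  · rintro ⟨b', hb', hxb, rfl⟩
    rw [← hxb, val_n, if_neg hb', sub_zero, val_n]
    exact ⟨⟨hn, le_rfl⟩, lt_irrefl n⟩

omit [Fintype B] in
/-- `ddist (cst 0) (prof Q) = |Q|`. [folklore] -/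
theorem ddist_cst_zero_prof (Q : Finset B) : ddist (cst θ hθ hθc 0) (prof θ hθ hθc Q) = Q.card := by
  rw [ddist, sdiff_cst_zero_prof, card_image_of_injective _ fun b b' h => by simpa using congrArg (fun P => (θ P).2) h]

/-- `ddist (cst 1) (prof Q) = |B| − |Q|`. [folklore] -/
theorem ddist_cst_one_prof (Q : Finset B) : ddist (cst θ hθ hθc 1) (prof θ hθ hθc Q) + Q.card = Fintype.card B := by
  rw [ddist, sdiff_cst_one_prof, card_image_of_injective _ fun b b' h => by simpa using congrArg (fun P => (θ P).2) h]
  have h := Finset.card_filter_add_card_filter_not (s := (univ : Finset B)) (fun b => b ∉ Q)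
  have e : univ.filter (fun b => ¬ b ∉ Q) = Q := by ext b; simp
  rw [e, card_univ] at h
  exact h

/-- **Witnesses at the centre `−1`**: every `θ⁻¹(−1, b)` deviates, so `|B| ≤ ddist (cst (−1)) (prof Q)` (`n ≥ 2`). [folklore] -/
theorem card_le_ddist_cst_neg_one_prof (hn : 2 ≤ n) (Q : Finset B) : Fintype.card B ≤ ddist (cst θ hθ hθc (-1)) (prof θ hθ hθc Q) := by
  have key : ∀ b : B, θ.symm (-1, b) ∈ (cst θ hθ hθc (-1)).1 \ (prof θ hθ hθc Q).1 := by
    intro b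
    have hneg : ((-1 : ZMod (2 * n))).val = 2 * n - 1 := by
      rw [ZMod.neg_val, if_neg (by
        intro h
        have h' := congrArg ZMod.val h
        rw [show (1 : ZMod (2 * n)) = ((1 : ℕ) : ZMod (2 * n)) by norm_cast, ZMod.val_cast_of_lt (by omega), ZMod.val_zero] at h'
        exact one_ne_zero h'), show (1 : ZMod (2 * n)) = ((1 : ℕ) : ZMod (2 * n)) by norm_cast, ZMod.val_cast_of_lt (by omega)]
    rw [mem_sdiff, symm_mem_cst, symm_mem_prof, sub_self, ZMod.val_zero]
    refine ⟨by omega, ?_⟩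
    split_ifs
    · rw [show (-1 : ZMod (2 * n)) - 1 = -1 - 1 from rfl, val_sub_eq, hneg,
        show (1 : ZMod (2 * n)) = ((1 : ℕ) : ZMod (2 * n)) by norm_cast, ZMod.val_cast_of_lt (by omega)]
      split_ifs <;> omega
    · rw [sub_zero, hneg]; omega
  calc Fintype.card B = (univ.image fun b : B => θ.symm ((-1 : ZMod (2 * n)), b)).card := by
        rw [card_image_of_injective _ (fun b b' hb => by simpa using congrArg (fun P => (θ P).2) hb), card_univ]
    _ ≤ _ := card_le_card fun P hP => by
        obtain ⟨b, -, rfl⟩ := mem_image.mp hP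
        exact key b

/-- **Witnesses at the centre `2`**: `θ⁻¹(n + 1, b)` for every `b` and `θ⁻¹(n, b)` for `b ∉ Q` deviate, so
`2|B| − |Q| ≤ ddist (cst 2) (prof Q)` (`n ≥ 2`). [folklore] -/
theorem card_le_ddist_cst_two_prof (hn : 2 ≤ n) (Q : Finset B) :
    2 * Fintype.card B ≤ ddist (cst θ hθ hθc 2) (prof θ hθ hθc Q) + Q.card := by
  have h2 : (2 : ZMod (2 * n)) = ((2 : ℕ) : ZMod (2 * n)) := by norm_cast
  have keyA : ∀ b : B, θ.symm (((n + 1 : ℕ) : ZMod (2 * n)), b) ∈ (cst θ hθ hθc 2).1 \ (prof θ hθ hθc Q).1 := by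
    intro b
    rw [mem_sdiff, symm_mem_cst, symm_mem_prof, h2, ← Nat.cast_sub (by omega), ZMod.val_cast_of_lt (by omega)]
    refine ⟨by omega, ?_⟩
    split_ifs
    · rw [show (1 : ZMod (2 * n)) = ((1 : ℕ) : ZMod (2 * n)) by norm_cast, ← Nat.cast_sub (by omega), ZMod.val_cast_of_lt (by omega)]
      omega
    · rw [sub_zero, ZMod.val_cast_of_lt (by omega)]; omega
  have keyB : ∀ b : B, b ∉ Q → θ.symm (((n : ℕ) : ZMod (2 * n)), b) ∈ (cst θ hθ hθc 2).1 \ (prof θ hθ hθc Q).1 := by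
    intro b hb
    rw [mem_sdiff, symm_mem_cst, symm_mem_prof, h2, ← Nat.cast_sub (by omega), ZMod.val_cast_of_lt (by omega), if_neg hb, sub_zero, val_n]
    exact ⟨by omega, lt_irrefl n⟩
  set WA : Finset G := univ.image fun b : B => θ.symm (((n + 1 : ℕ) : ZMod (2 * n)), b) with hWA
  set WB : Finset G := (univ.filter fun b : B => b ∉ Q).image fun b : B => θ.symm (((n : ℕ) : ZMod (2 * n)), b) with hWB
  have hinjA : Function.Injective fun b : B => θ.symm (((n + 1 : ℕ) : ZMod (2 * n)), b) :=
    fun b b' hb => by simpa using congrArg (fun P => (θ P).2) hb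
  have hinjB : Function.Injective fun b : B => θ.symm (((n : ℕ) : ZMod (2 * n)), b) :=
    fun b b' hb => by simpa using congrArg (fun P => (θ P).2) hb
  have hA : WA.card = Fintype.card B := by rw [hWA, card_image_of_injective _ hinjA, card_univ]
  have hB : WB.card + Q.card = Fintype.card B := by
    rw [hWB, card_image_of_injective _ hinjB]
    have h := Finset.card_filter_add_card_filter_not (s := (univ : Finset B)) (fun b => b ∉ Q)
    have e : univ.filter (fun b => ¬ b ∉ Q) = Q := by ext b; simp
    rw [e, card_univ] at h
    exact h
  have hdisj : Disjoint WA WB := by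
    rw [hWA, hWB, disjoint_iff_ne]
    rintro _ ha _ hb rfl
    obtain ⟨b, -, hb1⟩ := mem_image.mp ha
    obtain ⟨b', -, hb2⟩ := mem_image.mp hb
    have h := congrArg (fun P => (θ P).1) (hb1.trans hb2.symm)
    simp only [Equiv.apply_symm_apply] at h
    have h' := congrArg ZMod.val h
    rw [ZMod.val_cast_of_lt (by omega), val_n] at h'
    omega
  have hsub : WA ∪ WB ⊆ (cst θ hθ hθc 2).1 \ (prof θ hθ hθc Q).1 := by
    intro P hP
    rcases mem_union.mp hP with h | h
    · obtain ⟨b, -, rfl⟩ := mem_image.mp h; exact keyA b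
    · obtain ⟨b, hb, rfl⟩ := mem_image.mp h; exact keyB b (mem_filter.mp hb).2
  have := card_le_card hsub
  rw [card_union_of_disjoint hdisj] at this
  unfold ddist; omega

end Dev

/-! ## §2 The near classes of the profile corners -/

section NearCorners

variable [Fintype B]

/-- **`prof Q ∈ nearCl 0`** when `2|Q| < |B|` (`n ≥ 2`). [folklore] -/
theorem prof_mem_nearCl_zero (hc2 : c * c = 1) (hn : 2 ≤ n) (Q : Finset B) (hQ : 2 * Q.card < Fintype.card B) :
    prof θ hθ hθc Q ∈ nearCl θ hθ hθc 0 := by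
  have h0 := ddist_cst_zero_prof θ hθ hθc Q
  have h1 := ddist_cst_one_prof θ hθ hθc Q
  have hm := card_le_ddist_cst_neg_one_prof θ hθ hθc hn Q
  refine mem_nearCl_of_bounds θ hθ hθc hc2 (by omega) (by rw [zero_add]; omega) (by rw [zero_sub]; omega)

/-- **`(prof Q)^{(k, b₁)} ∈ nearCl 0`** for an interior place `1 ≤ k < n` of a column `b₁ ∉ Q`, when `2|Q| < |B|` and `3 ≤ |B|`. [folklore] -/
theorem oflipCM_prof_mem_nearCl_zero (hc2 : c * c = 1) (hn : 2 ≤ n) (hB : 3 ≤ Fintype.card B) (Q : Finset B)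
    (hQ : 2 * Q.card < Fintype.card B) {b₁ : B} (hb₁ : b₁ ∉ Q) {k : ℕ} (hk1 : 1 ≤ k) (hk : k < n) :
    oflipCM c hc2 (θ.symm ((k : ℕ), b₁)) (prof θ hθ hθc Q) ∈ nearCl θ hθ hθc 0 := by
  have hp0 := symm_natCast_mem_cst_zero θ hθ hθc hk b₁
  have hp1 := symm_natCast_mem_cst_one θ hθ hθc hk1 hk.le b₁
  have hpΦ := symm_natCast_mem_prof θ hθ hθc hk Q hb₁
  have h0 : ddist (cst θ hθ hθc 0) (oflipCM c hc2 (θ.symm ((k : ℕ), b₁)) (prof θ hθ hθc Q)) = Q.card + 1 := by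
    rw [ddist, sdiff_oflipCM_of_mem hc2 hp0 hpΦ, card_insert_of_notMem (fun h => (mem_sdiff.mp h).2 hpΦ), ← ddist,
      ddist_cst_zero_prof]
  have h1 : ddist (cst θ hθ hθc 1) (oflipCM c hc2 (θ.symm ((k : ℕ), b₁)) (prof θ hθ hθc Q)) + Q.card = Fintype.card B + 1 := by
    rw [ddist, sdiff_oflipCM_of_mem hc2 hp1 hpΦ, card_insert_of_notMem (fun h => (mem_sdiff.mp h).2 hpΦ), ← ddist,
      add_right_comm, ddist_cst_one_prof]
  have hm := card_le_ddist_cst_neg_one_prof θ hθ hθc hn Q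
  have hm' := ddist_le_ddist_oflipCM_add_one hc2 (cst θ hθ hθc (-1)) (prof θ hθ hθc Q) (θ.symm ((k : ℕ), b₁))
  refine mem_nearCl_of_bounds θ hθ hθc hc2 (by omega) (by rw [zero_add]; omega) (by rw [zero_sub]; omega)

/-- **`prof Q' ∈ nearCl 1`** when `|B| ≤ 2|Q'|` and `1 ≤ |Q'| ≤ |B|` (`n ≥ 2`; for even `|B| = 2|Q'|` this is a tie with the centre `0`, resolved
UPWARDS). [folklore] -/
theorem prof_mem_nearCl_one (hc2 : c * c = 1) (hn : 2 ≤ n) (Q' : Finset B) (hQ' : Fintype.card B ≤ 2 * Q'.card) (hQ1 : 1 ≤ Q'.card) :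
    prof θ hθ hθc Q' ∈ nearCl θ hθ hθc 1 := by
  have h0 := ddist_cst_zero_prof θ hθ hθc Q'
  have h1 := ddist_cst_one_prof θ hθ hθc Q'
  have h2 := card_le_ddist_cst_two_prof θ hθ hθc hn Q'
  have hle : Q'.card ≤ Fintype.card B := (card_le_univ Q').trans_eq (card_univ)
  refine mem_nearCl_of_bounds θ hθ hθc hc2 (by omega) (by rw [show (1 : ZMod (2 * n)) + 1 = 2 by norm_num]; omega)
    (by rw [sub_self]; omega)

/-- **`(prof Q')^{(k, b₁)} ∈ nearCl 1`** for an interior place of a column `b₁ ∉ Q'`, when `|B| ≤ 2|Q'|` and `3 ≤ |B|`. [folklore] -/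
theorem oflipCM_prof_mem_nearCl_one (hc2 : c * c = 1) (hn : 2 ≤ n) (hB : 3 ≤ Fintype.card B) (Q' : Finset B)
    (hQ' : Fintype.card B ≤ 2 * Q'.card) {b₁ : B} (hb₁ : b₁ ∉ Q') {k : ℕ} (hk1 : 1 ≤ k) (hk : k < n) :
    oflipCM c hc2 (θ.symm ((k : ℕ), b₁)) (prof θ hθ hθc Q') ∈ nearCl θ hθ hθc 1 := by
  have hp0 := symm_natCast_mem_cst_zero θ hθ hθc hk b₁
  have hp1 := symm_natCast_mem_cst_one θ hθ hθc hk1 hk.le b₁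
  have hpΦ := symm_natCast_mem_prof θ hθ hθc hk Q' hb₁
  have h0 : ddist (cst θ hθ hθc 0) (oflipCM c hc2 (θ.symm ((k : ℕ), b₁)) (prof θ hθ hθc Q')) = Q'.card + 1 := by
    rw [ddist, sdiff_oflipCM_of_mem hc2 hp0 hpΦ, card_insert_of_notMem (fun h => (mem_sdiff.mp h).2 hpΦ), ← ddist,
      ddist_cst_zero_prof]
  have h1 : ddist (cst θ hθ hθc 1) (oflipCM c hc2 (θ.symm ((k : ℕ), b₁)) (prof θ hθ hθc Q')) + Q'.card = Fintype.card B + 1 := by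
    rw [ddist, sdiff_oflipCM_of_mem hc2 hp1 hpΦ, card_insert_of_notMem (fun h => (mem_sdiff.mp h).2 hpΦ), ← ddist,
      add_right_comm, ddist_cst_one_prof]
  have h2 := card_le_ddist_cst_two_prof θ hθ hθc hn Q'
  have h2' := ddist_le_ddist_oflipCM_add_one hc2 (cst θ hθ hθc 2) (prof θ hθ hθc Q') (θ.symm ((k : ℕ), b₁))
  have hle : Q'.card < Fintype.card B := by
    have := card_lt_card (ssubset_univ_iff.mpr (ne_of_mem_of_not_mem' (mem_univ b₁) hb₁).symm); rwa [card_univ] at this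
  refine mem_nearCl_of_bounds θ hθ hθc hc2 (by omega) (by rw [show (1 : ZMod (2 * n)) + 1 = 2 by norm_num]; omega)
    (by rw [sub_self]; omega)

end NearCorners

end

end Summit.HodgeConjecture.CorCM.Census.TwistGeneration
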